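import Summits.HodgeConjecture.HodgeConjecture.Theorems.K2E1GlobaliseSquareIntegrableU2FiniteMeasureObstruction  -- ★ p854844 (conditional negative of dead #5)
import Summits.HodgeConjecture.HodgeConjecture.Theorems.K2E1OccursCountable                                      -- ★ p854792 socket #2 `OccursCountable`
import Literature.NumberTheory.Automorphic.AutomorphicGaloisConj                                                  -- ★ `ClosedSubrep.mapConj`, `IsConjEquivariant`
import Literature.NumberTheory.Automorphic.AdelicUnitaryGroupMeasureUniqueness                                    -- ★ `isAutomorphicMeasure_unique_smul_cmDatum`
import HarnessLib

/-!
# `K2E1OccursInDiscreteSpectrumSmulMeasure` — occurrence in the discrete spectrum does not depend on the normalisation of the automorphic measure;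
# the `v`-components of occurring families form a countable set; hence `sig_K2E1GlobaliseSquareIntegrableU2` (old bytes) is FALSE unconditionally

Track B ∕ K2-LIT, crux h413 = `stmt-HodgeConjecture-24833`, route of record `HCCMUnconditional`; prover seat `hodgecm-mathlib-K2E1-p05` (g0); lane
`--supports stmt-HodgeConjecture-24833` (count-neutral).  THEOREMS ONLY (no `def`, no `instance`, no notation, no named-fact hypothesis, no `sorry`).

**What is proved (kernel-checked).**
* §1 `exists_continuousLinearEquiv_Lp_smul_measure`: for `0 < c < ∞` the identity on functions is a continuous `ℂ`-linear isomorphism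
  `L²(μ) ≃L[ℂ] L²(c • μ)` (Mathlib `Lp.LpToLpOfMeasureLeSMul` both ways; `ae (c • μ) = ae μ`).
* §2 `exists_isConjEquivariant_rightRegular_smul_measure`: that isomorphism intertwines the regular representations `R_μ`, `R_{c•μ}` of `G(𝔸_K)` on
  `L²(G(𝔸_K) ⧸ A_G G(K), ·)` (★ `ClosedSubrep.IsConjEquivariant` with `θ = 1`), for every adelic group datum.
* §3 `occursInDiscreteSpectrum_of_isConjEquivariant`, `occursInDiscreteSpectrum_smul_measure_iff`, `cmOccursInDiscreteSpectrum_smul_measure_iff`: a family of local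
  classes of `U(J)` OCCURS in `L²_disc(c • μ)` iff it occurs in `L²_disc(μ)` (transport of ★ `DiscreteAutomorphicRep` along ★ `ClosedSubrep.mapConj`, of the finite
  component along ★ `ClosedSubrep.mapConjEquiv`).
* §4 `countable_setOf_component_cmOccursInDiscreteSpectrum`: for every CM field `L`, `H ∈ M_N(L)` and finite place `v` of `L⁺`, the set
  `{ρ v | μH automorphic, ρ occurs in L²_disc(U(H), μH)}` is COUNTABLE (★ `isAutomorphicMeasure_unique_smul_cmDatum` + §3 + ★ p854792 `OccursCountable`).
* §5 **`not_sig_K2E1GlobaliseSquareIntegrableU2`**: the dead socket #5 of `Cruxes/H413/Lines/K2_E1_TraceFormulaBetaSigs_GlobalIndex.lean` (§ DEAD SOCKETS (D2);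
  ED. 2 :107 bytes, `Pl` inlined) is FALSE — §4 discharges the hypothesis of ★ p854844 `not_sig_K2E1GlobaliseSquareIntegrableU2_of_countable_occurring`.

HONEST LABEL: HC_CM is proved only modulo the 7 printed citations (2 remaining named inputs: hLiu418 = `stmt-HodgeConjecture-24832`, h413 =
`stmt-HodgeConjecture-24833`) until rung 0 closes; this file proves no printed statement and moves no counter — §1–§4 are measure-normalisation bookkeeping
([BorelJacquet1979 §4.6]: the discrete spectrum is defined for THE invariant measure; the tree carries the normalisation as a parameter), §5 closes the book on
one dead socket.

## References
* [BorelJacquet1979] A. Borel, H. Jacquet, *Automorphic forms and automorphic representations*, Proc. Symp. Pure Math. 33.1 (1979), §4.6.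
* [Rogawski1990] J. D. Rogawski, *Automorphic Representations of Unitary Groups in Three Variables*, Ann. of Math. Stud. 123 (1990), §13.3 p. 201, §13.8 p. 218.
-/

set_option autoImplicit false
-- the mandated namespace repeats the single-problem summit's segment (`HodgeConjecture.HodgeConjecture`)
set_option linter.dupNamespace false

noncomputable section

open NumberField IsDedekindDomain MeasureTheory Filter Topology
open scoped ENNReal NNReal Matrix MatrixGroups
open Literature.NumberTheory.Rogawski1990 Literature.NumberTheory.Automorphic Literature.NumberTheory.Automorphic.UnitaryGroup
open Summit.HodgeConjecture.HodgeConjecture.Cruxes.H413.F0P3GlobalPacketDiscrete (OccursInDiscreteSpectrum cmOccursInDiscreteSpectrum)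

namespace Summit.HodgeConjecture.HodgeConjecture.Cruxes.H413.K2E1OccursInDiscreteSpectrumSmulMeasure

/-! ## §1 `L²(μ) ≃L[ℂ] L²(c • μ)`, the identity on functions -/

/-- **`L²(μ) ≃L[ℂ] L²(c • μ)` for `0 < c < ∞`**, acting as the identity on (a.e. classes of) functions: both inclusions are Mathlib's
`Lp.LpToLpOfMeasureLeSMul` (`c • μ ≤ c • μ`, `μ ≤ c⁻¹ • (c • μ)`), `ℂ`-linearity and the two-sided inverse property hold a.e. (`ae (c • μ) = ae μ`). [folklore] -/
theorem exists_continuousLinearEquiv_Lp_smul_measure {α : Type*} [MeasurableSpace α] (μ : Measure α) {c : ℝ≥0∞} (hc0 : c ≠ 0) (hc : c ≠ ⊤) :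
    ∃ e : Lp ℂ 2 μ ≃L[ℂ] Lp ℂ 2 (c • μ), ∀ f : Lp ℂ 2 μ, ((e f : Lp ℂ 2 (c • μ)) : α → ℂ) =ᵐ[μ] (f : α → ℂ) := by
  have hle₁ : c • μ ≤ c • μ := le_rfl
  have hle₂ : μ ≤ c⁻¹ • (c • μ) := by
    rw [smul_smul, ENNReal.inv_mul_cancel hc0 hc, one_smul]
  have hc' : c⁻¹ ≠ ⊤ := ENNReal.inv_ne_top.2 hc0
  have hae : ∀ {f g : α → ℂ}, f =ᵐ[c • μ] g ↔ f =ᵐ[μ] g := by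
    intro f g
    rw [Filter.EventuallyEq, Filter.EventuallyEq, Measure.ae_ennreal_smul_measure_eq hc0]
  let T : Lp ℂ 2 μ →L[ℝ] Lp ℂ 2 (c • μ) := Lp.LpToLpOfMeasureLeSMul (E := ℂ) (p := 2) (μ := c • μ) (ν := μ) hc hle₁
  let S : Lp ℂ 2 (c • μ) →L[ℝ] Lp ℂ 2 μ := Lp.LpToLpOfMeasureLeSMul (E := ℂ) (p := 2) (μ := μ) (ν := c • μ) hc' hle₂
  have hT : ∀ f : Lp ℂ 2 μ, ((T f : Lp ℂ 2 (c • μ)) : α → ℂ) =ᵐ[μ] (f : α → ℂ) := fun f =>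
    hae.1 (Lp.coeFn_LpToLpOfMeasureLeSMul hc hle₁ f)
  have hS : ∀ g : Lp ℂ 2 (c • μ), ((S g : Lp ℂ 2 μ) : α → ℂ) =ᵐ[μ] (g : α → ℂ) := fun g =>
    Lp.coeFn_LpToLpOfMeasureLeSMul hc' hle₂ g
  refine ⟨{ toLinearEquiv :=
              { toFun := T
                map_add' := fun f g => map_add T f g
                map_smul' := fun a f => ?_
                invFun := S
                left_inv := fun f => ?_
                right_inv := fun g => ?_ }
            continuous_toFun := T.continuous
            continuous_invFun := S.continuous }, hT⟩
  · -- `ℂ`-linearity, a.e.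
    apply Lp.ext
    refine hae.2 ?_
    filter_upwards [hT (a • f), Lp.coeFn_smul a f, hae.1 (Lp.coeFn_smul a (T f)), hT f] with x h1 h2 h3 h4
    rw [h1, h2, RingHom.id_apply, h3, Pi.smul_apply, Pi.smul_apply, h4]
  · apply Lp.ext
    filter_upwards [hS (T f), hT f] with x h1 h2
    rw [h1, h2]
  · apply Lp.ext
    refine hae.2 ?_
    filter_upwards [hT (S g), hS g] with x h1 h2
    rw [h1, h2]

/-! ## §2 The regular representations of `G(𝔸_K)` on `L²(μ)` and `L²(c • μ)` are equivalent -/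

section Regular

variable {K : Type} [Field K] [NumberField K] (𝒢 : AdelicGroupData K) (μ : Measure 𝒢.automorphicQuotient)
  [SMulInvariantMeasure 𝒢.Adelic 𝒢.automorphicQuotient μ]

/-- **`R_μ ≅ R_{c • μ}`**: the identity-on-functions isomorphism `L²(μ) ≃L[ℂ] L²(c • μ)` of §1 is `1`-conjugate equivariant (★ `ClosedSubrep.IsConjEquivariant`,
`θ = MulEquiv.refl`) between the regular representations, both being `(R g f)(x) = f(g⁻¹ • x)` a.e. (★ `rightRegular_apply_coeFn`); the composition with the
measure-preserving `x ↦ g⁻¹ • x` respects a.e. equality. [cite: BorelJacquet1979, §4.6] -/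
theorem exists_isConjEquivariant_rightRegular_smul_measure {c : ℝ≥0∞} (hc0 : c ≠ 0) (hc : c ≠ ⊤) :
    ∃ e : 𝒢.L2 μ ≃L[ℂ] 𝒢.L2 (c • μ),
      ContRepresentation.ClosedSubrep.IsConjEquivariant (𝒢.rightRegular μ) (𝒢.rightRegular (c • μ)) e (MulEquiv.refl 𝒢.Adelic) := by
  obtain ⟨e, he⟩ := exists_continuousLinearEquiv_Lp_smul_measure μ hc0 hc
  refine ⟨e, fun g f => ?_⟩
  apply Lp.ext
  have hae : ∀ {f₁ f₂ : 𝒢.automorphicQuotient → ℂ}, f₁ =ᵐ[c • μ] f₂ ↔ f₁ =ᵐ[μ] f₂ := by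
    intro f₁ f₂
    rw [Filter.EventuallyEq, Filter.EventuallyEq, Measure.ae_ennreal_smul_measure_eq hc0]
  have h1 : ((e (𝒢.rightRegular μ g f) : 𝒢.L2 (c • μ)) : 𝒢.automorphicQuotient → ℂ) =ᵐ[μ] fun x => (f : 𝒢.automorphicQuotient → ℂ) (g⁻¹ • x) :=
    (he _).trans (𝒢.rightRegular_apply_coeFn μ g f)
  have h2 : ((𝒢.rightRegular (c • μ) (MulEquiv.refl 𝒢.Adelic g) (e f) : 𝒢.L2 (c • μ)) : 𝒢.automorphicQuotient → ℂ) =ᵐ[μ]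
      fun x => ((e f : 𝒢.L2 (c • μ)) : 𝒢.automorphicQuotient → ℂ) (g⁻¹ • x) :=
    hae.1 (𝒢.rightRegular_apply_coeFn (c • μ) g (e f))
  have h3 : (fun x => ((e f : 𝒢.L2 (c • μ)) : 𝒢.automorphicQuotient → ℂ) (g⁻¹ • x)) =ᵐ[μ]
      fun x => (f : 𝒢.automorphicQuotient → ℂ) (g⁻¹ • x) :=
    (measurePreserving_smul g⁻¹ μ).quasiMeasurePreserving.ae_eq_comp (he f)
  exact hae.2 (h1.trans ((h2.trans h3).symm))

end Regular

/-! ## §3 Occurrence in the discrete spectrum of `U(J)` is unchanged under `μ ↦ a • μ` -/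

section Transport

variable {F E : Type} [Field F] [NumberField F] [Field E] [NumberField E] [Algebra F E] {c : E ≃ₐ[F] E} {N : ℕ}
  {J : Matrix (Fin N) (Fin N) E}
  {μ μ' : Measure (adelicGroupData F E c N J).automorphicQuotient}
  [SMulInvariantMeasure (adelicGroupData F E c N J).Adelic (adelicGroupData F E c N J).automorphicQuotient μ]
  [SMulInvariantMeasure (adelicGroupData F E c N J).Adelic (adelicGroupData F E c N J).automorphicQuotient μ']

/-- **Transport of occurrence along an equivalence of regular representations**: if `e : L²(μ) ≃L[ℂ] L²(μ')` intertwines `R_μ` and `R_{μ'}`, a family of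
local classes occurring in `L²_disc(μ)` occurs in `L²_disc(μ')` — the discrete automorphic `P` goes to `e(P)` (★ `ClosedSubrep.mapConj`, irreducible by ★
`isTopIrreducible_mapConj_iff`), its finite component `σ ↪ P` to `σ ↪ P ≃ e(P)` (★ `ClosedSubrep.mapConjEquiv`); the constituent clause does not see `μ`.
[cite: BorelJacquet1979, §4.6] -/
theorem occursInDiscreteSpectrum_of_isConjEquivariant
    (e : (adelicGroupData F E c N J).L2 μ ≃L[ℂ] (adelicGroupData F E c N J).L2 μ')
    (he : ContRepresentation.ClosedSubrep.IsConjEquivariant ((adelicGroupData F E c N J).rightRegular μ)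
      ((adelicGroupData F E c N J).rightRegular μ') e (MulEquiv.refl _))
    {π : ∀ v : HeightOneSpectrum (𝓞 F), IrrClass (localPi E c N J v)} (h : OccursInDiscreteSpectrum μ π) :
    OccursInDiscreteSpectrum μ' π := by
  obtain ⟨P, W, _, _, σ, hirr, hsm, hadm, ⟨f, hf⟩, hiff⟩ := h
  let P' : DiscreteAutomorphicRep (adelicGroupData F E c N J) μ' :=
    ⟨P.space.mapConj he, (P.space.isTopIrreducible_mapConj_iff he).2 P.irreducible⟩
  let ι : P.space.toSubmodule →ₗ[ℂ] (P.space.mapConj he).toSubmodule := (P.space.mapConjEquiv he).toLinearEquiv.toLinearMap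
  have hι : ∀ (g : (adelicGroupData F E c N J).Adelic) (w : P.space.toSubmodule),
      ι (P.space.toContRep g w) = (P.space.mapConj he).toContRep g (ι w) := fun g w =>
    P.space.isConjEquivariant_mapConjEquiv he g w
  let f' : σ.IntertwiningMap P'.finRep :=
    { toLinearMap := ι ∘ₗ f.toLinearMap
      isIntertwining' := fun g => by
        refine LinearMap.ext fun w => ?_
        have hfw : f (σ g w) = P.finRep g (f w) := LinearMap.congr_fun (f.isIntertwining' g) w
        change ι (f (σ g w)) = P'.finRep g (ι (f w))
        rw [hfw]
        exact hι (finAdelicToAdelic F E c N J g) (f w) }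
  refine ⟨P', W, _, _, σ, hirr, hsm, hadm, ⟨f', ?_⟩, hiff⟩
  exact (P.space.mapConjEquiv he).injective.comp hf

omit [SMulInvariantMeasure (adelicGroupData F E c N J).Adelic (adelicGroupData F E c N J).automorphicQuotient μ'] in
/-- **Occurrence in `L²_disc` does not depend on the normalisation of the measure**: for `0 < a < ∞`, `π` occurs in `L²_disc(U(J), a • μ)` iff it occurs in
`L²_disc(U(J), μ)` (§2 both ways). [cite: BorelJacquet1979, §4.6] -/
theorem occursInDiscreteSpectrum_smul_measure_iff {a : ℝ≥0∞} (ha0 : a ≠ 0) (ha : a ≠ ⊤)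
    (π : ∀ v : HeightOneSpectrum (𝓞 F), IrrClass (localPi E c N J v)) :
    OccursInDiscreteSpectrum (a • μ) π ↔ OccursInDiscreteSpectrum μ π := by
  obtain ⟨e, he⟩ := exists_isConjEquivariant_rightRegular_smul_measure (adelicGroupData F E c N J) μ ha0 ha
  exact ⟨occursInDiscreteSpectrum_of_isConjEquivariant e.symm he.symm, occursInDiscreteSpectrum_of_isConjEquivariant e he⟩

end Transport

section CM

variable (L : Type) [Field L] [NumberField L] [IsCMField L] (N : ℕ) (H : Matrix (Fin N) (Fin N) L)
  (μ : Measure (adelicGroupData (↥(maximalRealSubfield L)) L (IsCMField.complexConj L) N H).automorphicQuotient)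
  [SMulInvariantMeasure (adelicGroupData (↥(maximalRealSubfield L)) L (IsCMField.complexConj L) N H).Adelic
    (adelicGroupData (↥(maximalRealSubfield L)) L (IsCMField.complexConj L) N H).automorphicQuotient μ]

/-- CM currency: `cmOccursInDiscreteSpectrum L N H (a • μ) π ↔ cmOccursInDiscreteSpectrum L N H μ π` for `0 < a < ∞`. [cite: Rogawski1990, §13.3 p. 201] -/
theorem cmOccursInDiscreteSpectrum_smul_measure_iff {a : ℝ≥0∞} (ha0 : a ≠ 0) (ha : a ≠ ⊤)
    (π : ∀ v : HeightOneSpectrum (𝓞 ↥(maximalRealSubfield L)), IrrClass ((cmDatum L N H).Local v)) :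
    cmOccursInDiscreteSpectrum L N H (a • μ) π ↔ cmOccursInDiscreteSpectrum L N H μ π :=
  occursInDiscreteSpectrum_smul_measure_iff ha0 ha _

end CM

/-! ## §4 The `v`-components of occurring families form a countable set (all automorphic measures at once) -/

section Countable

variable (L : Type) [Field L] [NumberField L] [IsCMField L] (N : ℕ) (H : Matrix (Fin N) (Fin N) L)

/-- **Countability of occurring `v`-components over ALL automorphic measures.**  Automorphic measures on `U(H)(L⁺)\U(H)(𝔸_{L⁺})` are unique up to a positive
scalar (★ `isAutomorphicMeasure_unique_smul_cmDatum`), occurrence is scalar-invariant (§3), and for ONE automorphic measure the occurring families are countable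
(★ p854792 `OccursCountable`, [BorelJacquet1979 §4.6]); project to the place `v`. [cite: BorelJacquet1979, §4.6] [cite: Rogawski1990, §13.3 p. 201] -/
theorem countable_setOf_component_cmOccursInDiscreteSpectrum (v : HeightOneSpectrum (𝓞 ↥(maximalRealSubfield L))) :
    {c₀ : IrrClass ((UnitaryGroup.cmDatum L N H).Local v) |
        ∃ (μH : Measure (adelicGroupData (↥(maximalRealSubfield L)) L (IsCMField.complexConj L) N H).automorphicQuotient)
          (_ : (adelicGroupData (↥(maximalRealSubfield L)) L (IsCMField.complexConj L) N H).IsAutomorphicMeasure μH)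
          (ρ : ∀ u : HeightOneSpectrum (𝓞 ↥(maximalRealSubfield L)), IrrClass ((UnitaryGroup.cmDatum L N H).Local u)),
          cmOccursInDiscreteSpectrum L N H μH ρ ∧ ρ v = c₀}.Countable := by
  by_cases hex : ∃ μ₀ : Measure (adelicGroupData (↥(maximalRealSubfield L)) L (IsCMField.complexConj L) N H).automorphicQuotient,
      (adelicGroupData (↥(maximalRealSubfield L)) L (IsCMField.complexConj L) N H).IsAutomorphicMeasure μ₀
  · obtain ⟨μ₀, hμ₀⟩ := hex
    haveI := hμ₀
    have hcount := K2E1OccursCountable.OccursCountable L N H μ₀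
    refine (hcount.image fun ρ => ρ v).mono ?_
    rintro c₀ ⟨μH, hμH, ρ, hocc, rfl⟩
    -- `μH = a • μ₀` for a positive scalar `a`
    obtain ⟨a, ha0, haμ⟩ := @isAutomorphicMeasure_unique_smul_cmDatum L _ _ _ N H μH μ₀ hμH hμ₀
    subst haμ
    refine ⟨ρ, ?_, rfl⟩
    -- the `ℝ≥0`- and `ℝ≥0∞`-scalings agree definitionally; the invariance instances are proofs of a `Prop`
    have hocc' : cmOccursInDiscreteSpectrum L N H ((a : ℝ≥0∞) • μ₀) ρ := hocc
    exact (cmOccursInDiscreteSpectrum_smul_measure_iff L N H μ₀ (ENNReal.coe_ne_zero.2 ha0) ENNReal.coe_ne_top ρ).1 hocc'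
  · convert Set.countable_empty
    ext c₀
    simp only [Set.mem_setOf_eq, Set.mem_empty_iff_false, iff_false]
    rintro ⟨μH, hμH, -, -, -⟩
    exact hex ⟨μH, hμH⟩

end Countable

/-! ## §5 The dead socket #5 `sig_K2E1GlobaliseSquareIntegrableU2` is false, unconditionally -/

/-- **`¬ sig_K2E1GlobaliseSquareIntegrableU2` (old bytes of `Cruxes/H413/Lines/K2_E1_TraceFormulaBetaSigs_GlobalIndex.lean`, ED. 2 :107 = § DEAD SOCKETS (D2),
pasted verbatim with the organ's reducible `Pl L = HeightOneSpectrum (𝓞 L⁺)` inlined).**  §4 discharges the countability hypothesis of ★ p854844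
`not_sig_K2E1GlobaliseSquareIntegrableU2_of_countable_occurring` (finite open-positive `μZ` + uncountably many unitary characters at a split place).  The live
R-twin `sig_K2E1GlobaliseSquareIntegrableU2R` (`[μZ.IsHaarMeasure]`) is untouched. [cite: Rogawski1990, §13.8 p. 218 (i)–(iii)] [cite: BorelJacquet1979, §4.6] -/
theorem not_sig_K2E1GlobaliseSquareIntegrableU2 :
    ¬ (∀ (L : Type) [Field L] [NumberField L] [IsCMField L] (Φ : Matrix (Fin 2) (Fin 2) L),
      Φ = Matrix.of (fun i j : Fin 2 => if i.val + j.val + 1 = 2 then (1 : L) else 0) →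
      ∀ (v : HeightOneSpectrum (𝓞 ↥(maximalRealSubfield L)))
        [MeasurableSpace ((UnitaryGroup.cmDatum L 2 Φ).Local v ⧸ Subgroup.center ((UnitaryGroup.cmDatum L 2 Φ).Local v))]
        [BorelSpace ((UnitaryGroup.cmDatum L 2 Φ).Local v ⧸ Subgroup.center ((UnitaryGroup.cmDatum L 2 Φ).Local v))]
        (μZ : Measure ((UnitaryGroup.cmDatum L 2 Φ).Local v ⧸ Subgroup.center ((UnitaryGroup.cmDatum L 2 Φ).Local v)))
        [μZ.IsOpenPosMeasure] [IsFiniteMeasureOnCompacts μZ]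
        (ρ₀ : IrrClass ((UnitaryGroup.cmDatum L 2 Φ).Local v)), ρ₀.IsAdmissible → ρ₀.IsSquareIntegrable μZ →
        ∃ (μH : Measure (adelicGroupData (↥(maximalRealSubfield L)) L (IsCMField.complexConj L) 2 Φ).automorphicQuotient)
          (_ : (adelicGroupData (↥(maximalRealSubfield L)) L (IsCMField.complexConj L) 2 Φ).IsAutomorphicMeasure μH)
          (ρ : ∀ u : HeightOneSpectrum (𝓞 ↥(maximalRealSubfield L)), IrrClass ((UnitaryGroup.cmDatum L 2 Φ).Local u)),
          cmOccursInDiscreteSpectrum L 2 Φ μH ρ ∧ ρ v = ρ₀ ∧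
            ∀ u : HeightOneSpectrum (𝓞 ↥(maximalRealSubfield L)), u ≠ v → ∃ K : Subgroup ((UnitaryGroup.cmDatum L 2 Φ).Local u),
              IsOpen (K : Set ((UnitaryGroup.cmDatum L 2 Φ).Local u)) ∧ IsCompact (K : Set ((UnitaryGroup.cmDatum L 2 Φ).Local u)) ∧
                (ρ u).IsSpherical K) :=
  K2E1GlobaliseSquareIntegrableU2FiniteMeasureObstruction.not_sig_K2E1GlobaliseSquareIntegrableU2_of_countable_occurring
    fun L _ _ _ Φ v => countable_setOf_component_cmOccursInDiscreteSpectrum L 2 Φ v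

/-! ## §6 (APPEND, dealer K2E1-plan 21:27:30Z) Any two automorphic measures have the same occurring families -/

section TwoMeasures

variable (L : Type) [Field L] [NumberField L] [IsCMField L] (N : ℕ) (H : Matrix (Fin N) (Fin N) L)

/-- **Occurrence in the discrete spectrum of `U(H)` is the same for ANY two automorphic measures** (they differ by a positive scalar, ★
`isAutomorphicMeasure_unique_smul_cmDatum`; §3): the «∃ μ automorphic, π occurs for μ» and «∀ μ automorphic, π occurs for μ» readings of print's «π occurs in
L²_d(G)» coincide. [cite: BorelJacquet1979, §4.6] [cite: Rogawski1990, §13.3 p. 201] -/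
theorem cmOccursInDiscreteSpectrum_iff_of_isAutomorphicMeasure
    (μ ν : Measure (adelicGroupData (↥(maximalRealSubfield L)) L (IsCMField.complexConj L) N H).automorphicQuotient)
    [hμ : (adelicGroupData (↥(maximalRealSubfield L)) L (IsCMField.complexConj L) N H).IsAutomorphicMeasure μ]
    [hν : (adelicGroupData (↥(maximalRealSubfield L)) L (IsCMField.complexConj L) N H).IsAutomorphicMeasure ν]
    (π : ∀ v : HeightOneSpectrum (𝓞 ↥(maximalRealSubfield L)), IrrClass ((cmDatum L N H).Local v)) :
    cmOccursInDiscreteSpectrum L N H μ π ↔ cmOccursInDiscreteSpectrum L N H ν π := by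
  obtain ⟨a, ha0, haμ⟩ := @isAutomorphicMeasure_unique_smul_cmDatum L _ _ _ N H μ ν hμ hν
  subst haμ
  -- the `ℝ≥0`- and `ℝ≥0∞`-scalings agree definitionally; the invariance instances are proofs of a `Prop`
  exact cmOccursInDiscreteSpectrum_smul_measure_iff L N H ν (a := (a : ℝ≥0∞)) (ENNReal.coe_ne_zero.2 ha0) ENNReal.coe_ne_top π

/-- The «∃ automorphic measure» and «∀ automorphic measure» forms of occurrence agree (given one automorphic measure, e.g. ★
`exists_isAutomorphicMeasure_cmDatum_of_isHermitian`). [cite: BorelJacquet1979, §4.6] -/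
theorem exists_cmOccursInDiscreteSpectrum_iff_forall
    (ν : Measure (adelicGroupData (↥(maximalRealSubfield L)) L (IsCMField.complexConj L) N H).automorphicQuotient)
    [(adelicGroupData (↥(maximalRealSubfield L)) L (IsCMField.complexConj L) N H).IsAutomorphicMeasure ν]
    (π : ∀ v : HeightOneSpectrum (𝓞 ↥(maximalRealSubfield L)), IrrClass ((cmDatum L N H).Local v)) :
    (∃ (μ : Measure (adelicGroupData (↥(maximalRealSubfield L)) L (IsCMField.complexConj L) N H).automorphicQuotient)
        (_ : (adelicGroupData (↥(maximalRealSubfield L)) L (IsCMField.complexConj L) N H).IsAutomorphicMeasure μ),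
        cmOccursInDiscreteSpectrum L N H μ π) ↔
      ∀ (μ : Measure (adelicGroupData (↥(maximalRealSubfield L)) L (IsCMField.complexConj L) N H).automorphicQuotient)
        (_ : (adelicGroupData (↥(maximalRealSubfield L)) L (IsCMField.complexConj L) N H).IsAutomorphicMeasure μ),
        cmOccursInDiscreteSpectrum L N H μ π := by
  constructor
  · rintro ⟨μ, hμ, h⟩ μ' hμ'
    exact (cmOccursInDiscreteSpectrum_iff_of_isAutomorphicMeasure L N H μ' μ π).2 h
  · intro h
    exact ⟨ν, inferInstance, h ν inferInstance⟩

end TwoMeasures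

end Summit.HodgeConjecture.HodgeConjecture.Cruxes.H413.K2E1OccursInDiscreteSpectrumSmulMeasure

end
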